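import Summits.HodgeConjecture.HodgeConjecture.Theorems.F0LD2SoftRoadBricks
import HarnessLib

/-!
# LD2 soft road — THE GLUE of the organ `LineThetaTypesComplementary₁` over the ★ bricks leaf (sorry-free, kernel lane)

Cell `hodgecm-mathlib` (D-0151), half A line LD2, seat LD2-plan (g3), 2026-09-02; crux hLiu418 = `stmt-HodgeConjecture-24832` (count-neutral
helper, `--supports`).  The four bricks (E) `CentreDetCharExists`, (Z) `AnisotropicPlaneCentreTypeVanishes`, (D) `KudlaLinesDisjoint`,
(C) `CoinvDisjoint₁` are ★ `Theorems/F0LD2SoftRoadBricks.lean` (p850965); this file proves, with NO `sorry`: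

* `kudlaLinesDisjoint_of_vanishes : CentreDetCharExists → AnisotropicPlaneCentreTypeVanishes → KudlaLinesDisjoint` — (E)+(Z) ⇒ (D) through
  ★ E3 `nontrivial_theta_localSplittingCMWith_lines_iff_exists_type_neg_of_eq` [cite: Kudla1994, Thm 3.1; HarrisKudlaSweet1996, §6];
* `lineThetaTypesComplementary₁_of_coinvDisjoint₁ : CoinvDisjoint₁ → LineThetaTypesComplementary₁` — ★ π1
  `lineThetaTypesComplementary₁_of_coinv_disjoint` (`Theorems/F0LD2LineComplementaryOfDisjoint.lean`);
* `lineThetaTypesComplementary₁_of_softRoad : CentreDetCharExists → AnisotropicPlaneCentreTypeVanishes → (KudlaLinesDisjoint → CoinvDisjoint₁) →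
  LineThetaTypesComplementary₁` — the composition the leaf `Cruxes/HLiu418/Lines/F0_P6LD_StubS1bFactsOrganRoad.lean` will instantiate at the ★
  payers ((E) ★ `F0LD2CentreDetCharExists.centreDetCharExists` p850926, (D)→(C) ★ `F0LD2KudlaLinesToCoinvDisjoint.coinvDisjoint₁_of_kudlaLinesDisjoint`
  p850948, (Z) = `anisotropicPlaneCentreTypeVanishes_of_zBricks zLambda_holds zVan_holds` when ★).

HONEST LABEL: HC_CM is proved only modulo the 7 printed citations (2 remaining: hLiu418 = stmt-HodgeConjecture-24832, h413 =
stmt-HodgeConjecture-24833) until rung 0 closes; this file is count-neutral.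
-/

set_option autoImplicit false
set_option linter.dupNamespace false

noncomputable section

open scoped Matrix Kronecker
open NumberField IsDedekindDomain MeasureTheory
open Literature.NumberTheory Literature.NumberTheory.Automorphic Literature.NumberTheory.Automorphic.UnitaryGroup
open Literature.RepresentationTheory Literature.RepresentationTheory.HeisenbergGroup Literature.RepresentationTheory.TwistedCoinv
open Literature.NumberTheory.GelbartRogawski1991 Literature.NumberTheory.GelbartRogawski1991.UnitaryDualPair
open Literature.NumberTheory.GelbartRogawski1991.UnitaryDualPair.WeilCoinv
open Literature.NumberTheory.GelbartRogawski1991.UnitaryDualPair.LocalSplitting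
open Literature.NumberTheory.GelbartRogawski1991.GRConstruction
open Literature.NumberTheory.Weil1964
open Literature.NumberTheory.GaloisRepresentations Literature.RepresentationTheory.HarrisKudlaSweet1996
open Literature.NumberTheory.Automorphic.IdeleClassGroup Literature.RepresentationTheory.Liu2021
open Literature.NumberTheory.Automorphic.Liu2021 Literature.NumberTheory.Automorphic.Liu2021.Def411WeilCarriers
open Literature.NumberTheory.Automorphic.Liu2021.Def411WeilCarriersDoubling
open Literature.NumberTheory.Automorphic.Liu2021.LemD1RankTwoCMLetters
open Literature.RepresentationTheory.MoeglinVignerasWaldspurger1987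
open Literature.NumberTheory.QuadraticForms
open Summit.HodgeConjecture.HodgeConjecture.Cruxes.HLiu418.F0LD2LineThetaTypesComplementaryDefs
open Summit.HodgeConjecture.HodgeConjecture.Cruxes.HLiu418.F0LD2LineComplementaryOfDisjoint

namespace Summit.HodgeConjecture.HodgeConjecture.Cruxes.HLiu418.F0LD2SoftRoadJunction

/-! ## §1 The four bricks are ★ `Theorems/F0LD2SoftRoadBricks.lean` (p850965, commit f106c601822e)
`Summits/HodgeConjecture/HodgeConjecture/Theorems/F0LD2SoftRoadBricks.lean`, SAME namespace: `CentreDetCharExists` (E),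
`AnisotropicPlaneCentreTypeVanishes` (Z), `KudlaLinesDisjoint` (D), `CoinvDisjoint₁` (C) are IMPORTED, not restated (DEALS #14: one
currency for every hand; heads literal over the leaf). -/

/-! ## §2 The kernel-checked glue -/

set_option synthInstance.maxHeartbeats 400000 in
set_option maxHeartbeats 4000000 in -- block-currency terms
/-- **(E) + (Z) ⟹ (D)**: disjointness of the two line packages from the vanishing of the centre type of the anisotropic plane, by ★ E3
`nontrivial_theta_localSplittingCMWith_lines_iff_exists_type_neg_of_eq` («`Θ_{s_T}(e′) ≠ 0 ⟺` a common type exists»). [cite: Kudla1994, §3 Thm. 3.1]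
[cite: HarrisKudlaSweet1996, §6 Thm. 6.1] -/
theorem kudlaLinesDisjoint_of_vanishes (hex : CentreDetCharExists) (hZ : AnisotropicPlaneCentreTypeVanishes) : KudlaLinesDisjoint := by
  intro L _ _ _ v _ _ μ _ hE T₁ T₂ hT₁ hT₂ hT₁d hT₂d α hTT' hclass T hT hTs hTd J₁ hJ₁ J₁' hJ₁' J₂ hJ₂ J hJ χ hχ J' hJ'0 ζ hζ h₁ h₂
  obtain ⟨e', he'o, he'⟩ := hex L v (J₁ := J₁) hJ'0 χ
  exact hZ L v μ hE hT₁ hT₂ hT₁d hT₂d α hTT' hclass hT hTs hTd hJ₁ hJ χ hχ hJ'0 e' he'o he'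
    ((nontrivial_theta_localSplittingCMWith_lines_iff_exists_type_neg_of_eq L v μ hE hT₁ hT₂ hT₁d hT₂d hT hTs hTd hJ₁ hJ₁' hJ₂ hJ χ hχ
      hJ'0 e' he'o he').mpr ⟨ζ, hζ, h₁, h₂⟩)

set_option synthInstance.maxHeartbeats 400000 in
set_option maxHeartbeats 4000000 in -- the CM θ-package section terms
/-- **(C) ⟹ the organ**, ★ π1 `lineThetaTypesComplementary₁_of_coinv_disjoint` by name. [cite: MoeglinVignerasWaldspurger1987, Chap. 3 §IV.4 Théorème principal] -/
theorem lineThetaTypesComplementary₁_of_coinvDisjoint₁ (h : CoinvDisjoint₁) : LineThetaTypesComplementary₁ :=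
  lineThetaTypesComplementary₁_of_coinv_disjoint h

/-! ## §3 The composition -/

/-- **THE SOFT ROAD CLOSES THE ORGAN**: `(E) → (Z) → ((D) → (C)) → LineThetaTypesComplementary₁` (no `sorry`). -/
theorem lineThetaTypesComplementary₁_of_softRoad (hex : CentreDetCharExists) (hZ : AnisotropicPlaneCentreTypeVanishes)
    (htr : KudlaLinesDisjoint → CoinvDisjoint₁) : LineThetaTypesComplementary₁ :=
  lineThetaTypesComplementary₁_of_coinvDisjoint₁ (htr (kudlaLinesDisjoint_of_vanishes hex hZ))


end Summit.HodgeConjecture.HodgeConjecture.Cruxes.HLiu418.F0LD2SoftRoadJunction
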